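import Summits.CriticalPhenomena.PercolationContinuityZ3.Theorems.PercNearOneGluingNoHeavyLowerTailSunflowerMultiPetalTileG
import Summits.CriticalPhenomena.PercolationContinuityZ3.Theorems.PercNearOneGluingNoHeavyLowerTailSunflowerMultiPetalDual
import HarnessLib
import HarnessLib.Audit

/-!
# `NoHeavyLowerTail` (crux stmt-CriticalPhenomena-4575), abstract sunflower cubic, `k` petals: Conjecture G (and ★ₖ) for every structure tiled by NON-TOP CO-MODULES —
# all blow-ups of the `m`-arm CO-STAR, every `m` — by duality from `…MultiPetalTileG`

Support file (seat `prim-l12-p2` gen 33; `--supports stmt-CriticalPhenomena-4575`; companion of `…SunflowerMultiPetalTileG` (this gen: G for structures tiled by non-bottom modules)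
and `…SunflowerMultiPetalDual` (p368605: `MSunflower.dual`, `lab_dual`, `ZKflip_dual_compl`)).  Everything here is PROVED; no `sorry`.
Memo: run/shared/lean/prim/prim-l12/prim-l12-p2/FINDING-g33-MODULE-LIFT.md §1.12.

* `IsModule.dual` : a module `(M, g)` of `F` is a module of the dual structure, with the dual gadget `T ↦ ¬ g (M ∖ T)`.
* **`ZKflip_nonneg_of_comodules_cover`**: if `univ` is a disjoint union of modules `M i` of `F` with `lab (M i)ᶜ ≠ ⊤` (the tiles are NON-BOTTOM modules of the DUAL structure),
  then `0 ≤ ZKflip D` for every `D`, and (`ZK_nonneg_of_comodules_cover`) `0 ≤ ZK`.  The dual of a `θ_m`-blow-up is a blow-up of the `m`-arm CO-STAR (⊥ if ≤ m−2 arms fire,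
  petal `j` if exactly the arms `≠ j` fire, ⊤ if all fire) and conversely; so this is **★ₖ and Conjecture G for every co-star blow-up, every number of arms** (p360158 had ★ₖ for
  three arms), including the doubled star and all cloned stars `co-star(d₁,…,d_m)`.
-/

namespace Summit.CriticalPhenomena.PercolationContinuityZ3.Theorems.SunflowerPartition

open Finset

variable {α : Type*} [DecidableEq α] [Fintype α]

namespace MSunflower

variable {k : ℕ} (F : MSunflower k α)

/-- **A module of `F` is a module of the dual structure** (dual gadget `T ↦ ¬ g (M ∖ T)`). [this work] -/
theorem IsModule.dual {M : Finset α} {g : Finset α → Bool} (hF : F.IsModule M g) : F.dual.IsModule M (fun T => !g (M \ T)) := by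
  intro X
  rw [F.lab_dual, F.lab_dual]
  congr 1
  dsimp only
  have hMX : M \ (X ∩ M) = Xᶜ ∩ M := by
    ext x; simp only [mem_sdiff, mem_inter, mem_compl]; tauto
  simp only [hMX]
  have key := hF Xᶜ
  cases hg : g (Xᶜ ∩ M)
  · -- `g` does not fire on the trace of `Xᶜ`: the dual gadget fires
    simp only [hg, Bool.not_false, Bool.false_eq_true, if_false, if_true, union_empty] at key ⊢
    rw [key]
    congr 1
    ext x; simp only [mem_compl, mem_union, mem_sdiff]; tauto
  · -- `g` fires: the dual gadget does not
    simp only [hg, Bool.not_true, Bool.false_eq_true, if_false, if_true, union_empty] at key ⊢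
    rw [key]
    congr 1
    ext x; simp only [mem_compl, mem_union, mem_sdiff]; tauto

/-- **CONJECTURE G FOR STRUCTURES TILED BY NON-TOP CO-MODULES** (every co-star blow-up, every number of arms): if `univ` is a disjoint union of modules `M i` with
`lab (M i)ᶜ ≠ ⊤`, then `0 ≤ ZKflip D` for every `D`. [this work] -/
theorem ZKflip_nonneg_of_comodules_cover {ι : Type*} [DecidableEq ι] (s : Finset ι) (M : ι → Finset α) (g : ι → (Finset α → Bool))
    (hmod : ∀ i ∈ s, F.IsModule (M i) (g i)) (hlab : ∀ i ∈ s, F.lab (M i)ᶜ ≠ Fin.last (k + 1))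
    (hdisj : ∀ i ∈ s, ∀ j ∈ s, i ≠ j → Disjoint (M i) (M j)) (hcov : s.biUnion M = univ) (D : Finset α) : 0 ≤ F.ZKflip D := by
  rw [← F.ZKflip_dual_compl D]
  refine F.dual.ZKflip_nonneg_of_modules_cover s M (fun i => fun T => !g i (M i \ T)) (fun i hi => (hmod i hi).dual) ?_ hdisj hcov Dᶜ
  intro i hi h
  rw [F.lab_dual] at h
  exact hlab i hi ((swapTB_eq_zero_iff k _).1 h)

/-- **★ₖ for structures tiled by non-top co-modules** (every co-star blow-up, every number of arms): `0 ≤ ZK`. [this work] -/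
theorem ZK_nonneg_of_comodules_cover {ι : Type*} [DecidableEq ι] (s : Finset ι) (M : ι → Finset α) (g : ι → (Finset α → Bool))
    (hmod : ∀ i ∈ s, F.IsModule (M i) (g i)) (hlab : ∀ i ∈ s, F.lab (M i)ᶜ ≠ Fin.last (k + 1))
    (hdisj : ∀ i ∈ s, ∀ j ∈ s, i ≠ j → Disjoint (M i) (M j)) (hcov : s.biUnion M = univ) : 0 ≤ F.ZK := by
  rw [← F.ZKflip_empty]
  exact F.ZKflip_nonneg_of_comodules_cover s M g hmod hlab hdisj hcov ∅

end MSunflower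

end Summit.CriticalPhenomena.PercolationContinuityZ3.Theorems.SunflowerPartition
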